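import Summits.NavierStokesRegularity.NavierStokesRegularity.Theorems.SheetLawsOddContrastEquation
import Summits.NavierStokesRegularity.NavierStokesRegularity.Theorems.SheetLawsOddClassKinematics
import Literature.Analysis.FluidPDE.SwirlMaximumPrinciple
import Literature.Analysis.FluidPDE.SereginZajaczkowski2007L42VorticityProofs
import HarnessLib

/-!
# SHEET LAWS (ROUND-21 of nsreg-p2), engine step (2): the odd-contrast equation for the SMOOTH
# representative `χ̃ = zQuot Γ`, off the axis INCLUDING the sheet

Prover seat nsreg-p4 (gen 14), line material of the route `SwirlThreshold`
(`--supports stmt-NavierStokesRegularity-2002`); theorems only.  For a classical solution of the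
unforced Navier–Stokes system on `[s, t] × ℝ³` (`s < t`) in the axisymmetric odd-swirl class:

* `smoothContrast_family` — `(τ, x) ↦ χ̃(τ, x) = zQuot (swirl (u τ)) x` is jointly smooth on
  `[s, t] × ℝ³` (Hadamard quotient of the jointly smooth swirl family, `SheetLawsHadamardZ`);
* `smoothContrast_equation` — at EVERY point off the axis (sheet points included), with
  `c̃ = zQuot u_z` (the smooth compression rate, `= u_z/z` off the sheet, `= ∂_z u_z` on it) and
  `Q = zQuot (∂₂χ̃)` (`= (∂_zχ̃)/z` off the sheet, `= ∂_z²χ̃` on it):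
  `∂ₜχ̃ + Dχ̃[u] + c̃ χ̃ = ν (Δχ̃ − (2/r) Dχ̃[e_r] + 2 Q)`.
  Off the sheet this is the planner's kernel certificate [A1] `SheetLaws.oddContrast_transport`
  (the literal `χ = Γ/z` agrees with `χ̃` on the open set `{z ≠ 0}`, so all derivatives agree); ON the
  sheet it follows by continuity of every term in `x` and density of `{z ≠ 0}`
  (`SheetLaws.eq_zero_of_forall_off_sheet`);
* `zQuot_apply_two_add_nonneg` — a continuous compression majorant `-u_z/z ≤ k` off the sheet bounds
  the smooth rate everywhere: `0 ≤ c̃ + k`.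

WHAT THIS IS NOT: identities for classical solutions; no regularity claim, no route item proved.
-/

namespace Summit.NavierStokesRegularity.NavierStokesRegularity.Theorems.SheetLaws

open MeasureTheory Set Filter Topology Metric WithLp Function
open scoped ContDiff RealInnerProductSpace Laplacian
open Literature.Analysis Literature.Analysis.FluidPDE

noncomputable section

variable {s t ν : ℝ} {u : ℝ → EuclideanSpace ℝ (Fin 3) → EuclideanSpace ℝ (Fin 3)}
  {p : ℝ → EuclideanSpace ℝ (Fin 3) → ℝ}

/-! ## Joint smoothness of `χ̃` and its time derivative -/

/-- **`χ̃ = zQuot Γ` is jointly smooth** on `[s, t] × ℝ³` along a classical solution. -/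
theorem smoothContrast_family (hst : s < t) (hcl : IsClassicalNSSolutionOn (Icc s t) ν 0 u p) :
    IsSmoothSpaceTimeOn (Icc s t) fun τ => zQuot (swirl (u τ)) :=
  IsSmoothSpaceTimeOn.zQuot_family hcl.smooth_velocity.swirl_family (convex_Icc s t)
    (uniqueDiffOn_Icc hst)

/-- The time derivative of `χ̃` within `[s, t]` is jointly smooth; in particular each slice is
continuous. -/
theorem continuous_timeDerivWithin_smoothContrast (hst : s < t)
    (hcl : IsClassicalNSSolutionOn (Icc s t) ν 0 u p) {τ : ℝ} (hτ : τ ∈ Icc s t) :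
    Continuous (timeDerivWithin (Icc s t) (fun σ => zQuot (swirl (u σ))) τ) :=
  (((smoothContrast_family hst hcl).timeDerivWithin (uniqueDiffOn_Icc hst)).contDiff_slice hτ).continuous

/-- Slices of `χ̃` are smooth. -/
theorem contDiff_smoothContrast (hcl : IsClassicalNSSolutionOn (Icc s t) ν 0 u p) {τ : ℝ}
    (hτ : τ ∈ Icc s t) {n : ℕ∞} : ContDiff ℝ n (zQuot (swirl (u τ))) :=
  contDiff_zQuot (contDiff_swirl ((hcl.contDiff_velocity hτ).of_le (mod_cast le_top)))

/-- Off the sheet the time lines of the literal contrast `χ = Γ/z` and of `χ̃` coincide on `[s, t]`,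
hence so do their time derivatives within `[s, t]`. -/
theorem timeDerivWithin_oddContrast_eq (hcl : IsClassicalNSSolutionOn (Icc s t) ν 0 u p)
    (hodd : ∀ τ ∈ Icc s t, IsAxisymmetric (u τ) ∧ IsOddSwirlClass (u τ))
    {τ : ℝ} (hτ : τ ∈ Icc s t) {x : EuclideanSpace ℝ (Fin 3)} (hx : x 2 ≠ 0) :
    timeDerivWithin (Icc s t) (fun σ => oddContrast (u σ)) τ x =
      timeDerivWithin (Icc s t) (fun σ => zQuot (swirl (u σ))) τ x := by
  simp only [timeDerivWithin_apply]
  have heq : ∀ σ ∈ Icc s t, oddContrast (u σ) x = zQuot (swirl (u σ)) x := fun σ hσ =>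
    oddContrast_eq_zQuot ((hcl.contDiff_velocity hσ).of_le (by norm_cast)) (hodd σ hσ).1
      (hodd σ hσ).2 hx
  exact derivWithin_congr (fun σ hσ => heq σ hσ) (heq τ hτ)

/-- Off the sheet `χ` and `χ̃` agree near `x`. -/
theorem oddContrast_eventuallyEq_zQuot {v : EuclideanSpace ℝ (Fin 3) → EuclideanSpace ℝ (Fin 3)}
    (hv : ContDiff ℝ 1 v) (hax : IsAxisymmetric v) (hodd : IsOddSwirlClass v)
    {x : EuclideanSpace ℝ (Fin 3)} (hx : x 2 ≠ 0) :
    oddContrast v =ᶠ[𝓝 x] zQuot (swirl v) := by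
  have hopen : IsOpen {y : EuclideanSpace ℝ (Fin 3) | y 2 ≠ 0} :=
    isOpen_ne_fun (continuous_apply 2 |>.comp (PiLp.continuous_ofLp 2 _)) continuous_const
  filter_upwards [hopen.mem_nhds hx] with y hy
  exact oddContrast_eq_zQuot hv hax hodd hy

/-- The vertical derivative `∂₂χ̃` is `C¹`, vanishes on the sheet, hence `z · Q = ∂₂χ̃` everywhere
for its Hadamard quotient `Q = zQuot (∂₂χ̃)`. -/
theorem mul_zQuot_fderiv_two {v : EuclideanSpace ℝ (Fin 3) → EuclideanSpace ℝ (Fin 3)}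
    (hv : ContDiff ℝ 3 v) (hax : IsAxisymmetric v) (hodd : IsOddSwirlClass v)
    (x : EuclideanSpace ℝ (Fin 3)) :
    x 2 * zQuot (fun y => fderiv ℝ (zQuot (swirl v)) y (EuclideanSpace.single 2 1)) x =
      fderiv ℝ (zQuot (swirl v)) x (EuclideanSpace.single 2 1) := by
  have h2 : ContDiff ℝ 2 (zQuot (swirl v)) := contDiff_zQuot (n := 2) (contDiff_swirl (by exact_mod_cast hv))
  have h1 : ContDiff ℝ 1 fun y => fderiv ℝ (zQuot (swirl v)) y (EuclideanSpace.single 2 1) :=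
    (h2.fderiv_right (m := 1) le_rfl).clm_apply contDiff_const
  exact mul_zQuot h1 (fun y hy => fderiv_zQuot_swirl_two_of_sheet (hv.of_le (by norm_cast)) hax hodd hy) x

/-! ## The equation off the sheet (transfer of the kernel certificate [A1]) -/

/-- **The `χ̃`-equation off the sheet and off the axis** (transfer of `SheetLaws.oddContrast_transport`
from the literal `χ = Γ/z`, which agrees with `χ̃` on the open set `{z ≠ 0}`). -/
theorem smoothContrast_equation_off_sheet (hst : s < t)
    (hcl : IsClassicalNSSolutionOn (Icc s t) ν 0 u p)
    (hodd : ∀ τ ∈ Icc s t, IsAxisymmetric (u τ) ∧ IsOddSwirlClass (u τ))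
    {τ : ℝ} (hτ : τ ∈ Icc s t) {x : EuclideanSpace ℝ (Fin 3)} (hr : cylRadius x ≠ 0) (hz : x 2 ≠ 0) :
    timeDerivWithin (Icc s t) (fun σ => zQuot (swirl (u σ))) τ x
      + fderiv ℝ (zQuot (swirl (u τ))) x (u τ x)
      + zQuot (fun y => u τ y 2) x * zQuot (swirl (u τ)) x =
      ν * ((Δ (zQuot (swirl (u τ)))) x
            - 2 / cylRadius x * fderiv ℝ (zQuot (swirl (u τ))) x (eR x)
            + 2 * zQuot (fun y => fderiv ℝ (zQuot (swirl (u τ))) y (EuclideanSpace.single 2 1)) x) := by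
  have hax : ∀ σ ∈ Icc s t, IsAxisymmetric (u σ) := fun σ hσ => (hodd σ hσ).1
  have hp : ∀ σ ∈ Icc s t, IsAxisymmetricScalar (p σ) := fun σ hσ =>
    hcl.isAxisymmetricScalar_pressure (uniqueDiffOn_Icc hst) hax (fun _ _ => isAxisymmetric_zero) hσ
  have hv1 : ContDiff ℝ 1 (u τ) := (hcl.contDiff_velocity hτ).of_le (by norm_cast)
  have hv3 : ContDiff ℝ 3 (u τ) := (hcl.contDiff_velocity hτ).of_le (by norm_cast)
  have hE := oddContrast_eventuallyEq_zQuot hv1 (hodd τ hτ).1 (hodd τ hτ).2 hz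
  -- the certificate for the literal contrast
  have h := oddContrast_transport hcl hax hp hτ hr hz
  rw [timeDerivWithin_oddContrast_eq hcl hodd hτ hz, convect_apply, partialDeriv_apply,
    partialDeriv_apply, hE.fderiv_eq, (InnerProductSpace.laplacian_congr_nhds hE).eq_of_nhds,
    oddContrast_eq_zQuot hv1 (hodd τ hτ).1 (hodd τ hτ).2 hz,
    sheetCompression_eq_neg_zQuot hv1 (hodd τ hτ).1 (hodd τ hτ).2 hz] at h
  -- `(2/z) ∂₂χ̃ = 2 Q`
  have hQ := mul_zQuot_fderiv_two hv3 (hodd τ hτ).1 (hodd τ hτ).2 x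
  have hQ' : 2 / x 2 * fderiv ℝ (zQuot (swirl (u τ))) x (EuclideanSpace.single 2 1) =
      2 * zQuot (fun y => fderiv ℝ (zQuot (swirl (u τ))) y (EuclideanSpace.single 2 1)) x := by
    rw [← hQ]; field_simp
  rw [hQ'] at h
  linarith [h]

/-! ## Continuity of the terms and the equation ON the sheet -/

/-- The residual of the `χ̃`-equation is continuous in `x` off the axis (fixed time). -/
theorem continuousOn_smoothContrast_residual (hst : s < t)
    (hcl : IsClassicalNSSolutionOn (Icc s t) ν 0 u p) {τ : ℝ} (hτ : τ ∈ Icc s t) :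
    ContinuousOn (fun x =>
      timeDerivWithin (Icc s t) (fun σ => zQuot (swirl (u σ))) τ x
        + fderiv ℝ (zQuot (swirl (u τ))) x (u τ x)
        + zQuot (fun y => u τ y 2) x * zQuot (swirl (u τ)) x
        - ν * ((Δ (zQuot (swirl (u τ)))) x
            - 2 / cylRadius x * fderiv ℝ (zQuot (swirl (u τ))) x (eR x)
            + 2 * zQuot (fun y => fderiv ℝ (zQuot (swirl (u τ))) y (EuclideanSpace.single 2 1)) x))
      {y : EuclideanSpace ℝ (Fin 3) | cylRadius y ≠ 0} := by
  have hvs : ContDiff ℝ ∞ (u τ) := hcl.contDiff_velocity hτ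
  have hχ : ContDiff ℝ ∞ (zQuot (swirl (u τ))) := contDiff_smoothContrast hcl hτ
  have hχ2 : ContDiff ℝ 2 (zQuot (swirl (u τ))) := hχ.of_le (by norm_cast)
  have hD : Continuous fun x => fderiv ℝ (zQuot (swirl (u τ))) x :=
    hχ.continuous_fderiv (by simp)
  have hu1 : ContDiff ℝ 1 fun y => u τ y 2 := contDiff_euclidean.1 (hvs.of_le (by norm_cast)) 2
  have hc : Continuous (zQuot fun y => u τ y 2) :=
    (contDiff_zQuot (n := 0) (by exact_mod_cast hu1)).continuous
  have hQ : Continuous (zQuot fun y => fderiv ℝ (zQuot (swirl (u τ))) y (EuclideanSpace.single 2 1)) := by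
    have h1 : ContDiff ℝ 1 fun y => fderiv ℝ (zQuot (swirl (u τ))) y (EuclideanSpace.single 2 1) :=
      (hχ2.fderiv_right (m := 1) le_rfl).clm_apply contDiff_const
    exact (contDiff_zQuot (n := 0) (by exact_mod_cast h1)).continuous
  have hT := continuous_timeDerivWithin_smoothContrast hst hcl hτ
  have hL : Continuous (Δ (zQuot (swirl (u τ)))) := continuous_laplacian hχ2
  refine ((((hT.add (hD.clm_apply hvs.continuous)).add (hc.mul hχ.continuous)).continuousOn).sub
    ((continuousOn_const.mul ?_)))
  refine ((hL.continuousOn.sub ?_).add (continuousOn_const.mul hQ.continuousOn))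
  exact ((continuousOn_const.div continuous_cylRadius.continuousOn fun y hy => hy).mul
    (hD.continuousOn.clm_apply SereginZajaczkowski2007.continuousOn_eR))

/-- **The `χ̃`-equation off the axis, sheet points included.**  For a classical solution of the
unforced Navier–Stokes system on `[s, t] × ℝ³` in the axisymmetric odd-swirl class, at every
`τ ∈ [s, t]` and every `x` off the axis:
`∂ₜχ̃ + Dχ̃(x)[u] + c̃ χ̃ = ν (Δχ̃ − (2/r) Dχ̃(x)[e_r] + 2 Q)` with `χ̃ = zQuot Γ`, `c̃ = zQuot u_z`,
`Q = zQuot (∂₂χ̃)` (all smooth across the sheet).  Off the sheet this is [A1]; on the sheet it follows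
by continuity in `x` and density of `{z ≠ 0}`. -/
theorem smoothContrast_equation (hst : s < t)
    (hcl : IsClassicalNSSolutionOn (Icc s t) ν 0 u p)
    (hodd : ∀ τ ∈ Icc s t, IsAxisymmetric (u τ) ∧ IsOddSwirlClass (u τ))
    {τ : ℝ} (hτ : τ ∈ Icc s t) {x : EuclideanSpace ℝ (Fin 3)} (hr : cylRadius x ≠ 0) :
    timeDerivWithin (Icc s t) (fun σ => zQuot (swirl (u σ))) τ x
      + fderiv ℝ (zQuot (swirl (u τ))) x (u τ x)
      + zQuot (fun y => u τ y 2) x * zQuot (swirl (u τ)) x =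
      ν * ((Δ (zQuot (swirl (u τ)))) x
            - 2 / cylRadius x * fderiv ℝ (zQuot (swirl (u τ))) x (eR x)
            + 2 * zQuot (fun y => fderiv ℝ (zQuot (swirl (u τ))) y (EuclideanSpace.single 2 1)) x) := by
  by_cases hz : x 2 ≠ 0
  · exact smoothContrast_equation_off_sheet hst hcl hodd hτ hr hz
  · push Not at hz
    have hcont := continuousOn_smoothContrast_residual hst hcl hτ (ν := ν)
    have hopen : IsOpen {y : EuclideanSpace ℝ (Fin 3) | cylRadius y ≠ 0} :=
      isOpen_ne_fun continuous_cylRadius continuous_const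
    have hres := eq_zero_of_forall_off_sheet (hcont.continuousAt (hopen.mem_nhds hr)) hz
      (fun y hy hry => by
        have hry' : cylRadius y ≠ 0 := by rw [hry]; exact hr
        have := smoothContrast_equation_off_sheet hst hcl hodd hτ hry' hy
        linarith)
    linarith

/-! ## Values of the smooth coefficients on the sheet; the compression majorant -/

/-- On the sheet `Q = zQuot (∂₂χ̃)` is the second vertical derivative `∂₂∂₂χ̃`. -/
theorem zQuot_fderiv_two_of_sheet (hcl : IsClassicalNSSolutionOn (Icc s t) ν 0 u p) {τ : ℝ}
    (hτ : τ ∈ Icc s t) {x : EuclideanSpace ℝ (Fin 3)} (hx : x 2 = 0) :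
    zQuot (fun y => fderiv ℝ (zQuot (swirl (u τ))) y (EuclideanSpace.single 2 1)) x =
      fderiv ℝ (fun y => fderiv ℝ (zQuot (swirl (u τ))) y (EuclideanSpace.single 2 1)) x
        (EuclideanSpace.single 2 1) := by
  have hχ2 : ContDiff ℝ 2 (zQuot (swirl (u τ))) := (contDiff_smoothContrast hcl hτ)
  have h1 : ContDiff ℝ 1 fun y => fderiv ℝ (zQuot (swirl (u τ))) y (EuclideanSpace.single 2 1) :=
    (hχ2.fderiv_right (m := 1) le_rfl).clm_apply contDiff_const
  exact zQuot_of_sheet ((h1.differentiable one_ne_zero) x) hx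

/-- **The smooth compression rate is bounded by the majorant everywhere**: if `-u_z/z ≤ k` off the
sheet then `0 ≤ zQuot u_z + k` at every point (on the sheet by continuity). -/
theorem zQuot_apply_two_add_nonneg (hcl : IsClassicalNSSolutionOn (Icc s t) ν 0 u p)
    (hodd : ∀ τ ∈ Icc s t, IsAxisymmetric (u τ) ∧ IsOddSwirlClass (u τ))
    {τ : ℝ} (hτ : τ ∈ Icc s t) {k : ℝ}
    (hk : ∀ x : EuclideanSpace ℝ (Fin 3), x 2 ≠ 0 → sheetCompression (u τ) x ≤ k)
    (x : EuclideanSpace ℝ (Fin 3)) : 0 ≤ zQuot (fun y => u τ y 2) x + k := by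
  have hv1 : ContDiff ℝ 1 (u τ) := (hcl.contDiff_velocity hτ).of_le (by norm_cast)
  have hoff : ∀ y : EuclideanSpace ℝ (Fin 3), y 2 ≠ 0 → 0 ≤ zQuot (fun y => u τ y 2) y + k := by
    intro y hy
    have h := hk y hy
    rw [sheetCompression_eq_neg_zQuot hv1 (hodd τ hτ).1 (hodd τ hτ).2 hy] at h
    linarith
  by_cases hz : x 2 ≠ 0
  · exact hoff x hz
  · push Not at hz
    have hc : Continuous fun y => zQuot (fun y => u τ y 2) y + k :=
      (contDiff_zQuot (n := 0) (by exact_mod_cast (contDiff_euclidean.1 hv1 2))).continuous.add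
        continuous_const
    exact ge_of_forall_off_sheet hc.continuousAt hz fun y hy _ _ => hoff y hy

end

end Summit.NavierStokesRegularity.NavierStokesRegularity.Theorems.SheetLaws
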